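import Mathlib
import HarnessLib
import Summits.Langlands.Langlands.Theses.SkinnerWilesDefectOne
import Summits.Langlands.Langlands.Theorems.ReducibleOrdinaryProModular.Negative.LevelAndRamification
import Summits.Langlands.Langlands.Theorems.SkinnerWilesDefectOneReducibleOrdinaryProModularDefs
import Summits.Langlands.Langlands.Theorems.SkinnerWilesDefectOneReducibleOrdinaryProModularChebotarevSupply
import Summits.Langlands.Langlands.Theorems.SkinnerWilesDefectOneReducibleOrdinaryProModularOrientedSteinbergDatum
import Summits.Langlands.Langlands.Theorems.SkinnerWilesDefectOneReducibleOrdinaryProModularOrientedLocalDatum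
import Summits.Langlands.Langlands.Theorems.SkinnerWilesDefectOneReducibleOrdinaryProModularSmallReducibleSteinbergLocusThinAux
import Summits.Langlands.Langlands.Theorems.SkinnerWilesDefectOneReducibleOrdinaryProModularSteinbergLocusCharZeroAux
import Summits.Langlands.Langlands.Theorems.SkinnerWilesDefectOneReducibleOrdinaryProModularSteinbergStrataAux
import Summits.Langlands.Langlands.Theorems.SkinnerWilesDefectOneReducibleOrdinaryProModularComplementRegimeClosedPointAux
import Summits.Langlands.Langlands.Theorems.SkinnerWilesDefectOneReducibleOrdinaryProModularIharaCrossingSpecialisationAux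
import Summits.Langlands.Langlands.Theorems.SkinnerWilesDefectOneReducibleOrdinaryProModularIharaCrossingDivisorAux
import Summits.Langlands.Langlands.Theorems.SkinnerWilesDefectOneReducibleOrdinaryProModularLevelRaisingDivisorAux
import Literature.NumberTheory.GaloisRepresentations.NearlyOrdinaryDeformationRing

/-!
# Line `steinberg-hyperplane` for the crux `SkinnerWilesDefectOne.ReducibleOrdinaryProModular`
(stmt-Langlands-12919) — LEAD SKELETON v5 (continuation lead prover-line-stmt-Langlands-12919-c1-0, 2026-08-16: = v4 of lead 0
with the last infrastructure file `…LevelRaisingDivisorAux` (p93582, now built) imported; same four registered stubs, same composition;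
c1 strata re-derivation of the heart recorded in the crux NOTES.md §5)

v4 header (lead 0, prover-line-stmt-Langlands-12919-0), kept verbatim below.

v1 = the planner's checked skeleton (`Cruxes/…/Lines/steinberg_hyperplane.lean`, 6 stubs S1–S6).  Its vocabulary
landed as `Theorems/SkinnerWilesDefectOneReducibleOrdinaryProModularDefs.lean` (p85254) and wave 1 LANDED
S1 `stub_chebotarevSupply` (p87470, …ChebotarevSupply.lean) and S2 `stub_orientedSteinbergDatum` (p90055,
…OrientedSteinbergDatum.lean + 4 aux files), both imported here and used BY NAME.

RESHAPE v2 (evidence `line-steinberg-hyperplane-S3-misstated.md` on the item):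
* S3 `stub_smallReducibleSteinbergLocus` was FALSE as registered whenever `ρ` has ≥ 2 ALIGNED places (v ∤ p ramified
  with `Ψ̄|_{D_v} = ω|_{D_v}`): the lift `Ψ⁺ = ν̃ε` lies on every Taylor–Steinberg hyperplane and carries a reducible
  Steinberg-shaped family of Krull dimension `t + 2` (route witness `V₅(11a1)|ℚ(√−2)`: `t = 2`).  Corrected heart
  S3' `stub_smallReducibleSteinbergLocusAligned` takes `AtMostOneAlignedPlace p ρ ρ₀`; the complement joins the
  regime stub, now S6' `stub_complementRegime` with hypothesis `¬ (UniqueAdmissibleExtension ρ ρ₀ ∧ AtMostOneAlignedPlace p ρ ρ₀)`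
  (NO mechanism on record there; it contains the 11a witness — honest shrinkage of the line's coverage).
* The engine audit showed `Models` records no locality of `φ`; the crossing needs `R/ker φ → ℚ̄_p` continuous.  New datum stub
  S2⁺ `stub_orientedLocalDatum` (conclusion `M.Models … ∧ M.IsLocalPoint`; the landed S2 construction gives it) and corrected
  crossing S5' `stub_iharaCrossingLocal` (extra hypothesis `M.IsLocalPoint`).  S4 `stub_steinbergLevelEngine` unchanged.
Composition: `by_cases (UniqueAdmissibleExtension ∧ AtMostOneAlignedPlace)`; inside: S3' → B; S1 (landed) → v₀; S2⁺ → M;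
S3' → small; S4 → C⁺; S5' → ProMod; outside: S6'.  Sorries only in `stub_*`.

The three v2 vocabulary items `IsAlignedPlace`, `AtMostOneAlignedPlace`, `ModelData.IsLocalPoint` LANDED as the append p90573 to the Defs file.
Wave 2 LANDED S2⁺ `stub_orientedLocalDatum` (p91095) and the infrastructure files …SmallReducibleSteinbergLocusThinAux (p91500: window/thin toolkit,
Steinberg pin), …ComplementRegimeClosedPointAux (p91223), …IharaCrossingSpecialisationAux (p91495: reduction of the crossing to a pro-modular prime ≤ ker φ).

LANDED REDUCTIONS of the open stubs (waves 2–3 + lead, all ACCEPTED; imported above for the record except …LevelRaisingDivisorAux p93582, not yet built on the farm at write time):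
* S3' = `ClosedPointStratumLE M.𝓡 3` at level S' ((C3) + the regime; needs the SW99 L2.7 dictionary for the char-`p` constant-Ψ
  pencil) + the MOVING-strata bound `∀ 𝔮 ∈ red ∩ St, ¬HasFiniteOrderRatio 𝔮 → dim ≤ 3` (G1 dictionary, G2 weak-Leopoldt torsion, G3 μ-type bound,
  `AtMostOneAlignedPlace` at the fixed point Ψ⁺): `smallReducibleSteinbergLocus_of_strata` (…SteinbergStrataAux p92914), the char-0 exclusion
  `not_hasFiniteOrderRatio_of_mem_steinbergLocus` (…SteinbergLocusCharZeroAux p92325), the pin `steinbergPin_ratio` and the thin/window toolkit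
  (…SmallReducibleSteinbergLocusThinAux p91500).
* S5' = pro-modularity of SOME prime `𝔮 ≤ ker φ` (`ModelData.Models.isPadicallyAutomorphic_of_le_ker`, …IharaCrossingDivisorAux p92146, and
  `stub_iharaCrossingLocal_auxReduction`, …IharaCrossingSpecialisationAux p92550); done ON the level-raising divisor (`proMod_of_ker_mem_steinbergLocus`:
  `ker φ ∈ steinbergLocus` ⇒ ProMod by C⁺; `ker φ ∉ reducibleLocus` for irreducible ρ), and the divisor IS in the Steinberg locus
  (`mem_steinbergLocus_of_levelRaising_mem`, …LevelRaisingDivisorAux p93582: unramified at v₀ + `q·tr² − (1+q)²·det ∈ 𝔮` at one Frobenius ⇒ St-shaped); what is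
  OPEN is (P1) DOWN from an irreducible level-raising prime 𝔭₁ of the component C_ρ to its minimal prime (Taylor's (1,1)/(χ₁,χ₂) trick inside CG/Hansen complexes at
  defect one; PatchingLocalComponentBarrier) and the existence of such 𝔭₁ (dim C_ρ ≥ 4, M3; caveat: a hypersurface section swallowed by a 3-dim reducible sheet needs a
  second Taylor–Steinberg place).
* S4: nothing landable — first missing fact (M1) = existence of the Eisenstein-localised P-ordinary Hecke datum over F attached to 𝕋(𝒰) (not in tree or print for F⁺ = ℚ);
  the v₀-seed (M2) is the route's `EisensteinProModularSeed` pinned at q := v₀; S4 ⊇ item stmt-Langlands-14718's content inside the Steinberg locus (crux-sized).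
* S6': regime predicate certified non-vacuous (…ComplementRegimeClosedPointAux p91223); no mechanism (ProModularityGL2 sector; contains the 11a witness).

Disproof used: `Cruxes/ReducibleOrdinaryProModular/Disproof.lean` (cdisprove v3, re-read 2026-08-16T08:00Z): no ¬-theorem,
no Targets; `crux_of_proModularity` (method hypotheses), `withoutAEUnramified_iff` (hunr necessary — used by the landed S1/S2),
level lemmas (our levels have `bad ⊇ S'`).  Negatives index: unrelated entry only.
-/

namespace Summit.Langlands.Langlands.Cruxes.ReducibleOrdinaryProModular.SteinbergHyperplane

set_option linter.dupNamespace false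
set_option linter.unusedVariables false

open scoped NumberField MatrixGroups
open Filter NumberField IsDedekindDomain Field Polynomial Matrix
open Literature.NumberTheory.Automorphic Literature.NumberTheory.Automorphic.BigHeckeGLn
open Literature.NumberTheory.GaloisRepresentations
open Summit.Langlands.Langlands.Theses.SkinnerWilesDefectOne

noncomputable section

/-! ## 0. v2 vocabulary `IsAlignedPlace`, `AtMostOneAlignedPlace`, `ModelData.IsLocalPoint`: LANDED (Defs v2, p90573) and imported. -/

/-! ## 1. The stubs of v2 (registered; `sorry` only here).  S1 `stub_chebotarevSupply` and S2
`stub_orientedSteinbergDatum` are LANDED and imported. -/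

/-! S2⁺ `stub_orientedLocalDatum` LANDED (p91095, …OrientedLocalDatum.lean) — imported and used by name. -/

/-- **Stub S3' `stub_smallReducibleSteinbergLocusAligned` — THE HEART, corrected (size XL; Galois/Iwasawa side only).**
As S3 of v1 with the NECESSARY extra hypothesis `AtMostOneAlignedPlace p ρ ρ₀` (`t ≤ 1`): in the regime
`UniqueAdmissibleExtension` (`m_{S♯} = 1`) there is a THIN set `B` such that for every Taylor–Steinberg `v₀` avoiding `B`
and every model at level `S' = S♯ ∪ {v₀}`, every reducible Steinberg-shaped prime has `dim R/𝔮 ≤ 3`.  Mechanism (card +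
wave-1 audit): reducible Steinberg-shaped points have `Ψ` on the moving divisor `D_{v₀} = {Ψ(Frob_{v₀}) = q_{v₀}}`; its unique
FIXED point `Ψ⁺ = ν̃ε` carries the `S'`-unit family of dimension `t + 2 ≤ 3` (this is where `AtMostOneAlignedPlace` is spent;
rank bound `≤ 1 + t` by Leopoldt/Brumer for the abelian-over-`F` field `F(ν)`, `v₀`-class steered by a thin ray-class
condition); the other fixed point `Ψ⁻ = Ψ̃⟨ε⟩⁻¹` is empty (Soulé); the MOVABLE strata — height-one support of the split
Iwasawa–Selmer module and of `H²_Iw` (torsion: weak Leopoldt for the `ℤ_p²`-tower of `F(Ψ̄)`), `μ`-components — are dodged by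
the direction of `Frob_{v₀}` (thin conditions, `isThin_preimage`); the closed-point stratum has dimension `m_{S'} + 1 ≤ 3`.
Why it might fail: the `μ`-type bound `rank_{k⟦Γ⟧} X_split/ϖ ≤ 1` on `D_{v₀} mod ϖ` is open for inert `p`; weak Leopoldt
for inert/ramified `p` in print only for split `p`; isotypic coincidences `Ψ̄² = ω^{±1}`.  NOT in the tree: SW99 Lemma 2.7
dictionary, Λ-adic Selmer modules, Rubin 1991 — expect `stub-blocked` on those named facts until they are filed.
Sources: SkinnerWiles1999 Lemmas 2.7–2.9; Rubin 1991; de Shalit 1987; Greenberg–Wiles (DDT Thm 2.19); Brumer 1967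
(Leopoldt for abelian-over-imaginary-quadratic fields); Soulé 1979; wave-1 evidence `line-steinberg-hyperplane-S3-misstated.md`. -/
theorem stub_smallReducibleSteinbergLocusAligned :
    ∀ (F : Type) [Field F] [NumberField F], IsTotallyComplex F → Module.finrank ℚ F = 2 →
      ∀ (p : ℕ) [Fact p.Prime], p ≠ 2 →
      ∀ (O : ValuationSubring (PadicAlgCl p)),
        O = (Valued.v : Valuation (PadicAlgCl p) NNReal).valuationSubring →
      ∀ (ρ : FramedGaloisRep F (PadicAlgCl p) 2) (ρ₀ : absoluteGaloisGroup F →* GL (Fin 2) O),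
        ρ.toGaloisRep.IsIrreducible → (∀ᶠ v in cofinite, ρ.IsUnramifiedAt v) →
        ρ.HasUpperTriangularIntegralModel ρ₀ → OrdLoc p O ρ ρ₀ →
        UniqueAdmissibleExtension ρ ρ₀ → AtMostOneAlignedPlace p ρ ρ₀ →
          ∃ B : Set (absoluteGaloisGroup F), IsThin p ρ₀ B ∧
            ∀ v₀ : HeightOneSpectrum (𝓞 F), TaylorSteinbergPlace p ρ ρ₀ v₀ → FrobAvoids B v₀ →
              ∀ M : ModelData F p, M.Models ρ ρ₀ (baseLevel ρ ∪ {v₀}) →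
                SmallReducibleSteinbergLocus M.𝓡 v₀ := by
  sorry

/-- **Stub S4 `stub_steinbergLevelEngine` — the Skinner–Wiles chain INSIDE the Steinberg locus: the transfer `C⁺`
(size XL; the ROUTE'S bet — TaylorWilesNumericalCoincidence at `l₀ = 1` — in Steinberg dress; shares its patching
core with every line of this crux).**  For a Taylor–Steinberg `v₀` and a model at level `S'` with small reducible
Steinberg locus, every IRREDUCIBLE Steinberg-shaped prime `𝔮` of `R_{𝒟'}` is pro-modular of a tame level with
`v₀ ∈ bad` (`SteinbergPrimesProModular`).  Intended proof = the route's foreseen children run on the closed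
subscheme `Z_St = steinbergLocus`: (0) PRESENTATION BOUND (triage X2): every irreducible component of `Z_St` has
`dim ≥ dim Λ_F + dim(local rings) − (relations) = 4` and Raynaud's `c(·) ≥ 3` — needs the local Borel ring at
`v ∣ p` Cohen–Macaulay in the obstructed case `Ψ̄|_{D_v} = ω^{±1}` (Snowden arXiv:1111.3654) and the Steinberg local
ring CM (Shotton2016; Taylor2008 §3 = arXiv:1812.09999 §6.2.5); (1) SEED at level `v₀`: `v₀` is residually level-raising (eigenvalues
`1,1`, `q ≡ 1`), so the route's `EisensteinProModularSeed` with its auxiliary place `q := v₀`, or the Eisenstein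
congruence at `cond(χ̄)·v₀` (Berger 2009 / DiamondTaylor1994-type raising), gives ONE nice prime on a large
Steinberg component; (2) TRANSPORT of extension classes (SW Prop. 4.2) and RAYNAUD connectivity over `Λ_F` (SW App. A)
inside `Z_St`, using `SmallReducibleSteinbergLocus` (margin exactly one: intersections of large St-components have
dim `≥ 3` and must not be reducible sheets — triage r1-2 (α): at margin one SW (III) can still stall on a 3-dim
reducible sheet shared by two components; repairs on record: card `unibranch-eisenstein-sheets` (DVR at the generic
point of the sheet) or a second TRANSVERSE pin (card `transverse-steinberg-ladder`)); GOOD ⟹ NICE needs a prime off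
the inertially-degenerate divisors `H_n(v)` at every `v ∣ p` (triage X1: the SECOND use of SW's (G) has no analogue
over `F`; Baire over countably many `H_n(v)` + (P1) at characteristic-0 dimension-one primes); (3) (P1) DEFECT-ONE
PATCHING at a nice prime `𝔭` RAMIFIED at `v₀` (interior of `Z_St`, where Taylor's local ring `R^{St}_{v₀}` is a
DOMAIN — no Ihara input at this step): Calegari–Geraghty / Hansen / Khare–Thorne two-term complexes localised at `𝔭`,
Scholze / Caraiani–Newton determinants for the `P`-ordinary Hecke algebra (`POrdinaryHeckeAlgebraGL2` interface) —
with the Hecke-side tax (triage (C6)): NO torsion ordinary local–global compatibility is in print over an imaginary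
quadratic `F` (CN23 Thm 4.2.15 hyp. (1), ACC+ Thm 5.5.1 "[F⁺:ℚ] > 1"), so the instance needs card
`eisenstein-lgc-at-nice-prime`'s solvable ascent/descent or a new LGC; (4) going UP from minimal primes of large
St-components to every irreducible St-prime (`IsProModularPrime.of_le` shape).  Why it might fail: everything in the
route crux's own why-might-fail (TW sets one short at `𝔭`, Raynaud over `Λ_F` untested, (C6)), plus margin-one
stalls (2).  Sources: SkinnerWiles1999 §§2.3–2.5, 4.1–4.4, App. A; CalegariGeraghty2017 §§5, 8; Hansen2012;
KhareThorne2017; Scholze2015 Cor. V.4.3; arXiv:2301.10509 Prop. 5.5.2, Thm 4.2.15; arXiv:1812.09999 Thm 5.5.1;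
Taylor2008 §3; Shotton2016; arXiv:1111.3654. -/
theorem stub_steinbergLevelEngine :
    ∀ (F : Type) [Field F] [NumberField F], IsTotallyComplex F → Module.finrank ℚ F = 2 →
      ∀ (p : ℕ) [Fact p.Prime], p ≠ 2 →
      ∀ (O : ValuationSubring (PadicAlgCl p)),
        O = (Valued.v : Valuation (PadicAlgCl p) NNReal).valuationSubring →
      ∀ (ρ : FramedGaloisRep F (PadicAlgCl p) 2) (ρ₀ : absoluteGaloisGroup F →* GL (Fin 2) O),
        ρ.toGaloisRep.IsIrreducible → (∀ᶠ v in cofinite, ρ.IsUnramifiedAt v) →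
        ρ.HasUpperTriangularIntegralModel ρ₀ → OrdLoc p O ρ ρ₀ →
        ∀ v₀ : HeightOneSpectrum (𝓞 F), TaylorSteinbergPlace p ρ ρ₀ v₀ →
          ∀ M : ModelData F p, M.Models ρ ρ₀ (baseLevel ρ ∪ {v₀}) →
            SmallReducibleSteinbergLocus M.𝓡 v₀ → SteinbergPrimesProModular M.𝓡 v₀ := by
  sorry

/-- **Stub S5' `stub_iharaCrossingLocal` (v2: + `M.IsLocalPoint`, the continuity datum of the specialisation; otherwise = v1's `stub_iharaCrossing`) — the bridge back to `ρ` through the level-raising divisor (size XL; HARDEST: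
PatchingLocalComponentBarrier bites here, triage r1-2 (β), r1-3 (ii); uses `hirr`).**  For a Taylor–Steinberg `v₀`
and a model `𝓡 ∋ 𝔭_ρ` at level `S'` with small reducible Steinberg locus in which every irreducible
Steinberg-shaped prime is pro-modular, `ρ` is `p`-adically automorphic of some tame level.  Intended proof:
`𝔭_ρ := ker φ` lies on a component `C_ρ` of `Spec R_{𝒟'}` (dim `≥ 4`, presentation bound), generically unramified at
`v₀`; the level-raising element `f_{v₀} := q·tr²ρ_𝒟(Frob_{v₀}) − (1+q)² det ρ_𝒟(Frob_{v₀}) ∈ 𝔪_R`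
(`= (qa − d)(a − qd)` on diagonal Frobenii) cuts `C_ρ` in an equidimensional `3`-fold `Y = V(f_{v₀}) ∩ C_ρ` every
point of which is Steinberg-shaped (unramified with eigenvalue ratio `q^{±1}`; in characteristic `p`, ratio `1 = q`);
`Y ⊄ reducibleLocus` because `Y ∩ R^{red} ⊆ R^{red} ∩ steinbergLocus` has dim `≤ 3` and `Y` is a hypersurface section
of an irreducible `4`-fold not contained in `R^{red}` (if a section is swallowed by a reducible sheet, use
`f_{v₀}·f_{v₀'}` with a second Taylor–Steinberg place — card); pick a dimension-one prime `𝔭₁ ∈ Y` off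
`R^{red}` and off the inertially-degenerate divisors `H_n(v)` (triage X1/K4, Baire) OF CHARACTERISTIC ZERO — an
`𝒪′`-point of `C_ρ`, Kisin-style (triage r1-1 K3 and X1's repair: Taylor's mod-`ϖ` comparison degenerates at
characteristic-`p` primes, and SW's char-`p` "nice" is not needed for a (P1) run at an `𝒪′`-point) — so `ρ_{𝔭₁}` is an
irreducible `p`-adic representation, unramified at `v₀` with eigenvalue ratio exactly `q_{v₀}`, Steinberg-shaped,
hence pro-modular of level `𝒰 ∋ v₀` by the hypothesis `C⁺` (which covers irreducible Steinberg-shaped primes of ANY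
characteristic); then ONE (P1) patching at `𝔭₁` for the `v₀`-UNIPOTENT problem (both local components pass through
`𝔭₁`) with TAYLOR'S TRICK — compare with the
`(χ₁,χ₂)`-typed problem, `χᵢ` of order `p` on `I_{v₀}` (available exactly because `N v₀ ≡ 1 (mod p)` and
`ρ̄|_{G_{v₀}} = 1`), whose local ring is irreducible, the two problems agreeing mod `ϖ` — inside the
Calegari–Geraghty/Hansen complexes at defect one (arXiv:1812.09999 §6.2.5 "Level raising deformations" — hypotheses VERBATIM ours: `q_v ≡ 1 mod p`,
`ρ̄|_{G_{F_v}}` trivial, `p > n`; `R_v^1` equidimensional with both components, `R_v^χ` irreducible — and §6.3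
"Avoiding Ihara's lemma", axiomatic derived form over a power-series base `Λ`, there for non-Eisenstein `𝔪`:
here relative to the irreducible `ρ_{𝔭₁}`, i.e. with card `eisenstein-lgc-at-nice-prime`'s relocation `𝔪 ↦ 𝔭₁`); output: every minimal prime of `(R_{𝒟'})_{𝔭₁}` is pro-modular of level `𝒰₁(v₀)`, in
particular the generic point of `C_ρ`, hence `𝔭_ρ` (`IsProModularPrime.of_le` shape), hence `ρ` via `φ`
(`Models.realizes`; continuity of `R/𝔭_ρ → ℚ̄_p` because `φ(𝔪_R)` is finitely generated inside `𝔪_O`), with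
`bad = S'` (landed `exists_isPadicallyAutomorphic_bad_eq`).  Why it might fail: Taylor's trick has never been run
at a non-classical `𝒪′`-point of a residually reducible family nor inside two-term complexes at an Eisenstein `𝔪`
(triage r1-3 (ii), r1-1 K3: the crossing support is ONE SHORT without it — (LR) = S4's seed-and-chain at level `v₀`,
(ML) = this stub); the other door — an Ihara lemma / level raising in Eisenstein-localised Bianchi Hida or completed homology
(SW99 §8 = Wiles Ch. 2 congruence modules) — is unproved over `F` (Calegari–Venkatesh tie torsion level-lowering to
`K₂`); (C6) Hecke-side tax as in S4; swallowed hypersurface sections.  Sources: Taylor2008 ("Automorphy II") §3; arXiv:1812.09999 §6.2.5, §6.3 (READ this session: p. 68, p. 73 of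
the text dump); SkinnerWiles1999 §4.2 (P1), §8; DiamondTaylor1994; CalegariGeraghty2017 §§5, 8;
CalegariVenkatesh2019; `Literature.Barriers.Langlands.PatchingLocalComponentBarrier` (`blocks:`/`evasions_known:`
(a)). -/
theorem stub_iharaCrossingLocal :
    ∀ (F : Type) [Field F] [NumberField F], IsTotallyComplex F → Module.finrank ℚ F = 2 →
      ∀ (p : ℕ) [Fact p.Prime], p ≠ 2 →
      ∀ (O : ValuationSubring (PadicAlgCl p)),
        O = (Valued.v : Valuation (PadicAlgCl p) NNReal).valuationSubring →
      ∀ (ρ : FramedGaloisRep F (PadicAlgCl p) 2) (ρ₀ : absoluteGaloisGroup F →* GL (Fin 2) O),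
        ρ.toGaloisRep.IsIrreducible → (∀ᶠ v in cofinite, ρ.IsUnramifiedAt v) →
        ρ.HasUpperTriangularIntegralModel ρ₀ → OrdLoc p O ρ ρ₀ →
        ∀ v₀ : HeightOneSpectrum (𝓞 F), TaylorSteinbergPlace p ρ ρ₀ v₀ →
          ∀ M : ModelData F p, M.Models ρ ρ₀ (baseLevel ρ ∪ {v₀}) → M.IsLocalPoint →
            SmallReducibleSteinbergLocus M.𝓡 v₀ → SteinbergPrimesProModular M.𝓡 v₀ → ProMod p ρ := by
  sorry

/-- **Stub S6' `stub_complementRegime` — REGIME STUB, honestly labelled (crux strength on the complement of the line's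
regime `UniqueAdmissibleExtension ∧ AtMostOneAlignedPlace`; NO mechanism on record; registered so that the composition
concludes the crux BY NAME for every `ρ`; do NOT staff it for proof).**  v2 widening of v1's `stub_largeSelmerRegime`: besides
`m_{S♯} ≥ 2` it now contains every `ρ` with ≥ 2 aligned places — INCLUDING the route's non-vacuity witness `V₅(11a1)|ℚ(√−2)`
(`t = 2`) and every 5-isogeny curve with ≥ 2 multiplicative places of norm `≡ 1 (mod 5)`.  Why plausibly true: instance of
`ProModularityGL2` (Disproof §4).  Recorded repairs (not this line's): the TRANSVERSE window of card transverse-steinberg-ladder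
(`q² ≢ 1`: no fixed-point stratum, `t` plays no role, price = the crossing without Taylor's trick and the excluded population
`ω² ∈ ⟨Ψ̄ω⟩`); the wave-1 S6 audit's sharper regime `AugmentedStratumSmall` (m_{S♯} = 2 with a nonzero dual class) is typable
over this vocabulary but moves only the `m`-boundary.  Sources: SkinnerWiles1999 Lemma 2.7; CalegariGeraghty2017 Rem 5.14;
GeeNewton2020 §3.3; wave-1 evidence. -/
theorem stub_complementRegime :
    ∀ (F : Type) [Field F] [NumberField F], IsTotallyComplex F → Module.finrank ℚ F = 2 →
      ∀ (p : ℕ) [Fact p.Prime], p ≠ 2 →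
      ∀ (O : ValuationSubring (PadicAlgCl p)),
        O = (Valued.v : Valuation (PadicAlgCl p) NNReal).valuationSubring →
      ∀ (ρ : FramedGaloisRep F (PadicAlgCl p) 2) (ρ₀ : absoluteGaloisGroup F →* GL (Fin 2) O),
        ρ.toGaloisRep.IsIrreducible → (∀ᶠ v in cofinite, ρ.IsUnramifiedAt v) →
        ρ.HasUpperTriangularIntegralModel ρ₀ → OrdLoc p O ρ ρ₀ →
        ¬ (UniqueAdmissibleExtension ρ ρ₀ ∧ AtMostOneAlignedPlace p ρ ρ₀) → ProMod p ρ := by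
  sorry

/-! ## 2. The composition: landed S1 + stubs ⟹ crux BY NAME (kernel-checked, no sorry of its own) -/

/-- **The line concludes the crux BY NAME (v2).**  Pure logic: case on the regime
`UniqueAdmissibleExtension ρ ρ₀ ∧ AtMostOneAlignedPlace p ρ ρ₀`; inside it S3' hands over a thin set `B`, the LANDED S1
(`stub_chebotarevSupply`) a Taylor–Steinberg place `v₀` avoiding `B`, S2⁺ the oriented datum `M` at level `S♯ ∪ {v₀}` with a
local specialisation; S3' makes its reducible Steinberg locus small, S4 makes its irreducible Steinberg-shaped primes
pro-modular (`C⁺`), S5' crosses back to `ρ`; outside the regime, S6'. -/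
theorem ReducibleOrdinaryProModular_of
    (h₃ :
      ∀ (F : Type) [Field F] [NumberField F], IsTotallyComplex F → Module.finrank ℚ F = 2 →
        ∀ (p : ℕ) [Fact p.Prime], p ≠ 2 →
        ∀ (O : ValuationSubring (PadicAlgCl p)),
          O = (Valued.v : Valuation (PadicAlgCl p) NNReal).valuationSubring →
        ∀ (ρ : FramedGaloisRep F (PadicAlgCl p) 2) (ρ₀ : absoluteGaloisGroup F →* GL (Fin 2) O),
          ρ.toGaloisRep.IsIrreducible → (∀ᶠ v in cofinite, ρ.IsUnramifiedAt v) →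
          ρ.HasUpperTriangularIntegralModel ρ₀ → OrdLoc p O ρ ρ₀ →
          UniqueAdmissibleExtension ρ ρ₀ → AtMostOneAlignedPlace p ρ ρ₀ →
            ∃ B : Set (absoluteGaloisGroup F), IsThin p ρ₀ B ∧
              ∀ v₀ : HeightOneSpectrum (𝓞 F), TaylorSteinbergPlace p ρ ρ₀ v₀ → FrobAvoids B v₀ →
                ∀ M : ModelData F p, M.Models ρ ρ₀ (baseLevel ρ ∪ {v₀}) →
                  SmallReducibleSteinbergLocus M.𝓡 v₀)
    (h₄ :
      ∀ (F : Type) [Field F] [NumberField F], IsTotallyComplex F → Module.finrank ℚ F = 2 →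
        ∀ (p : ℕ) [Fact p.Prime], p ≠ 2 →
        ∀ (O : ValuationSubring (PadicAlgCl p)),
          O = (Valued.v : Valuation (PadicAlgCl p) NNReal).valuationSubring →
        ∀ (ρ : FramedGaloisRep F (PadicAlgCl p) 2) (ρ₀ : absoluteGaloisGroup F →* GL (Fin 2) O),
          ρ.toGaloisRep.IsIrreducible → (∀ᶠ v in cofinite, ρ.IsUnramifiedAt v) →
          ρ.HasUpperTriangularIntegralModel ρ₀ → OrdLoc p O ρ ρ₀ →
          ∀ v₀ : HeightOneSpectrum (𝓞 F), TaylorSteinbergPlace p ρ ρ₀ v₀ →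
            ∀ M : ModelData F p, M.Models ρ ρ₀ (baseLevel ρ ∪ {v₀}) →
              SmallReducibleSteinbergLocus M.𝓡 v₀ → SteinbergPrimesProModular M.𝓡 v₀)
    (h₅ :
      ∀ (F : Type) [Field F] [NumberField F], IsTotallyComplex F → Module.finrank ℚ F = 2 →
        ∀ (p : ℕ) [Fact p.Prime], p ≠ 2 →
        ∀ (O : ValuationSubring (PadicAlgCl p)),
          O = (Valued.v : Valuation (PadicAlgCl p) NNReal).valuationSubring →
        ∀ (ρ : FramedGaloisRep F (PadicAlgCl p) 2) (ρ₀ : absoluteGaloisGroup F →* GL (Fin 2) O),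
          ρ.toGaloisRep.IsIrreducible → (∀ᶠ v in cofinite, ρ.IsUnramifiedAt v) →
          ρ.HasUpperTriangularIntegralModel ρ₀ → OrdLoc p O ρ ρ₀ →
          ∀ v₀ : HeightOneSpectrum (𝓞 F), TaylorSteinbergPlace p ρ ρ₀ v₀ →
            ∀ M : ModelData F p, M.Models ρ ρ₀ (baseLevel ρ ∪ {v₀}) → M.IsLocalPoint →
              SmallReducibleSteinbergLocus M.𝓡 v₀ → SteinbergPrimesProModular M.𝓡 v₀ → ProMod p ρ)
    (h₆ :
      ∀ (F : Type) [Field F] [NumberField F], IsTotallyComplex F → Module.finrank ℚ F = 2 →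
        ∀ (p : ℕ) [Fact p.Prime], p ≠ 2 →
        ∀ (O : ValuationSubring (PadicAlgCl p)),
          O = (Valued.v : Valuation (PadicAlgCl p) NNReal).valuationSubring →
        ∀ (ρ : FramedGaloisRep F (PadicAlgCl p) 2) (ρ₀ : absoluteGaloisGroup F →* GL (Fin 2) O),
          ρ.toGaloisRep.IsIrreducible → (∀ᶠ v in cofinite, ρ.IsUnramifiedAt v) →
          ρ.HasUpperTriangularIntegralModel ρ₀ → OrdLoc p O ρ ρ₀ →
          ¬ (UniqueAdmissibleExtension ρ ρ₀ ∧ AtMostOneAlignedPlace p ρ ρ₀) → ProMod p ρ) :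
    Summit.Langlands.Langlands.Theses.SkinnerWilesDefectOne.ReducibleOrdinaryProModular := by
  refine crux_iff.mpr ?_
  intro F _ _ hF hdeg p _ hp O hO ρ ρ₀ hirr hunr hmod hloc
  by_cases hR : UniqueAdmissibleExtension ρ ρ₀ ∧ AtMostOneAlignedPlace p ρ ρ₀
  · -- inside the regime: S3' gives the thin set to avoid
    obtain ⟨B, hB, hred⟩ := h₃ F hF hdeg p hp O hO ρ ρ₀ hirr hunr hmod hloc hR.1 hR.2
    -- S1 (LANDED): a Taylor–Steinberg place avoiding it
    obtain ⟨v₀, hv₀, hav⟩ := stub_chebotarevSupply F hF hdeg p hp O hO ρ ρ₀ hirr hunr hmod hloc B hB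
    -- S2⁺ (LANDED): the oriented Skinner–Wiles datum at level S♯ ∪ {v₀} with a local specialisation
    obtain ⟨M, hM, hMloc⟩ := stub_orientedLocalDatum F hF hdeg p hp O hO ρ ρ₀ hirr hunr hmod hloc v₀
    -- S3': reducible Steinberg locus small
    have hsm : SmallReducibleSteinbergLocus M.𝓡 v₀ := hred v₀ hv₀ hav M hM
    -- S4: the engine inside the Steinberg locus (C⁺)
    have hC : SteinbergPrimesProModular M.𝓡 v₀ :=
      h₄ F hF hdeg p hp O hO ρ ρ₀ hirr hunr hmod hloc v₀ hv₀ M hM hsm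
    -- S5': the crossing at v₀ brings pro-modularity back to ρ
    exact h₅ F hF hdeg p hp O hO ρ ρ₀ hirr hunr hmod hloc v₀ hv₀ M hM hMloc hsm hC
  · -- outside the regime: S6'
    exact h₆ F hF hdeg p hp O hO ρ ρ₀ hirr hunr hmod hloc hR

/-- The crux from the landed S1 and the five registered stubs of v2 (the only sorries are inside `stub_*`). -/
theorem ReducibleOrdinaryProModular_proof :
    Summit.Langlands.Langlands.Theses.SkinnerWilesDefectOne.ReducibleOrdinaryProModular :=
  ReducibleOrdinaryProModular_of stub_smallReducibleSteinbergLocusAligned stub_steinbergLevelEngine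
    stub_iharaCrossingLocal stub_complementRegime

end

end Summit.Langlands.Langlands.Cruxes.ReducibleOrdinaryProModular.SteinbergHyperplane
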